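import Literature.NumberTheory.Automorphic.ArchimedeanEnvelopingAction
import Literature.NumberTheory.Automorphic.AutomorphicForms
import HarnessLib

/-!
# The Lie algebra action of an automorphic representation of `GL_n(𝔸_K)` exists
(discharge of the named fact `AutomorphicRepData.exists_hasLieAction` for the `GL_n` datum)

Topic `NumberTheory/Automorphic`. For an automorphic representation datum `π = W / W'` of
`GL_n(𝔸_K)` (`AutomorphicRepData (AutomorphyDatum.gl n K hcpt)`; Borel–Jacquet 1979, 4.6) the
Lie algebra `𝔤 = 𝔤𝔩_n(K_∞)` acts on `W / W'` through the Lie derivatives: `W` and `W'` are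
`𝔤`-stable spaces of automorphic forms, hence of functions smooth in the archimedean variable,
on which `X ↦ (φ ↦ X φ)` is `ℝ`-linear in `X`, `ℂ`-linear in `φ` and compatible with brackets,
`[X, Y] φ = X (Y φ) - Y (X φ)` (`lieDeriv_bracket_gl`, `ArchimedeanLieBracket`); so it is a morphism
of real Lie algebras `𝔤 →ₗ⁅ℝ⁆ End_ℂ W` (`AutomorphicRepData.lieRepW`) descending to the quotient
`W / W'` (`AutomorphicRepData.lieRep`), and this action satisfies `ρ𝔤 X [φ] = [X φ]`
(`AutomorphicRepData.hasLieAction_lieRep`). Consequently the named fact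
`AutomorphicRepData.exists_hasLieAction` of `AutomorphicForms` holds for every automorphic
representation datum of `GL_n` (`AutomorphicRepData.exists_hasLieAction_gl`); by
`hasLieAction_unique` (tree) the action is `π.lieRep`. Borel–Jacquet 1979, §1.5 and 4.6.
Everything here is proved; the two definitions are the actions.

## References

* A. Borel, H. Jacquet, *Automorphic forms and automorphic representations*, Proc. Sympos. Pure
  Math. 33 (1979), part 1, §1.5 and 4.6 [BorelJacquet1979].
-/

-- Mathlib idiom (Mathlib/Algebra/Lie/OfAssociative.lean); needed to mention Lie subalgebras of matrix algebras
attribute [local instance 100] LieRing.ofAssociativeRing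

noncomputable section

open scoped MatrixGroups Matrix ContDiff Classical
open NumberField NumberField.mixedEmbedding IsDedekindDomain

namespace Literature.NumberTheory.Automorphic

namespace AutomorphicRepData

variable {n : ℕ} {K : Type} [Field K] [NumberField K] {hcpt : isCompact_glFiniteIntegralLevel n K}
  (π : AutomorphicRepData (AutomorphyDatum.gl n K hcpt))

/-- Elements of `W` are smooth in the archimedean variable (`W ≤ 𝒜`). [folklore] -/
theorem isArchSmooth_of_mem_W {φ : (AdelicGroupData.gl n K).Adelic → ℂ} (hφ : φ ∈ π.W) :
    IsArchSmooth (AutomorphyDatum.gl n K hcpt).ofArch φ :=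
  automorphicForms_le_archSmooth _ (π.stable.le_automorphicForms hφ)

/-- **The Lie algebra action on `W`**: `X ↦ (φ ↦ X φ)` as a morphism of real Lie algebras
`𝔤𝔩_n(K_∞) →ₗ⁅ℝ⁆ End_ℂ W` for an automorphic representation datum `π = W / W'` of `GL_n(𝔸_K)`
(`W` is `𝔤`-stable; linearity on smooth functions, and the bracket relation
`lieDeriv_bracket_gl`). Borel–Jacquet 1979, §1.5 and 4.6. [cite: BorelJacquet1979, 4.6] -/
def lieRepW : (AutomorphyDatum.gl n K hcpt).arch.lie →ₗ⁅ℝ⁆ Module.End ℂ π.W where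
  toFun X :=
    { toFun := fun φ => π.lieDerivW X φ
      map_add' := fun φ ψ => Subtype.ext
        (IsArchSmooth.lieDeriv_add _ X (π.isArchSmooth_of_mem_W φ.2) (π.isArchSmooth_of_mem_W ψ.2))
      map_smul' := fun c φ => Subtype.ext
        (lieDeriv_smul X c (φ : (AdelicGroupData.gl n K).Adelic → ℂ)) }
  map_add' X Y := LinearMap.ext fun φ =>
    Subtype.ext (IsArchSmooth.lieDeriv_add_left _ (π.isArchSmooth_of_mem_W φ.2) X Y)
  map_smul' a X := LinearMap.ext fun φ => Subtype.ext (by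
    change lieDeriv (AutomorphyDatum.gl n K hcpt).ofArch (a • X) φ =
      (a : ℂ) • lieDeriv (AutomorphyDatum.gl n K hcpt).ofArch X φ
    rw [IsArchSmooth.lieDeriv_smul_left _ (π.isArchSmooth_of_mem_W φ.2), real_smul_fun_eq_coe_smul])
  map_lie' {X Y} := LinearMap.ext fun φ => Subtype.ext (by
    change lieDeriv (AutomorphyDatum.gl n K hcpt).ofArch ⁅X, Y⁆ φ =
      lieDeriv (AutomorphyDatum.gl n K hcpt).ofArch X (lieDeriv (AutomorphyDatum.gl n K hcpt).ofArch Y φ) -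
        lieDeriv (AutomorphyDatum.gl n K hcpt).ofArch Y (lieDeriv (AutomorphyDatum.gl n K hcpt).ofArch X φ)
    exact lieDeriv_bracket_gl (π.isArchSmooth_of_mem_W φ.2) X Y)

/-- Unfolding: `π.lieRepW X φ = X φ` in `W`. [folklore] -/
theorem lieRepW_apply (X : (AutomorphyDatum.gl n K hcpt).arch.lie) (φ : π.W) :
    π.lieRepW X φ = π.lieDerivW X φ := rfl

/-- `W'` (inside `W`) is stable under the Lie algebra action on `W`. [folklore] -/
theorem kerQuot_le_comap_lieRepW (X : (AutomorphyDatum.gl n K hcpt).arch.lie) :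
    π.kerQuot ≤ π.kerQuot.comap (π.lieRepW X) := by
  intro φ hφ
  simp only [kerQuot, Submodule.mem_comap, Submodule.subtype_apply] at hφ ⊢
  exact π.stable'.lie_stable X _ hφ

/-- The Lie algebra action of `π` on `W / W'` as an `ℝ`-linear map (descent of `π.lieRepW` by
`Submodule.mapQ`). Borel–Jacquet 1979, 4.6. [cite: BorelJacquet1979, 4.6] -/
def lieRepLinear : (AutomorphyDatum.gl n K hcpt).arch.lie →ₗ[ℝ] Module.End ℂ π.Quot where
  toFun X := π.kerQuot.mapQ π.kerQuot (π.lieRepW X) (π.kerQuot_le_comap_lieRepW X)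
  map_add' X Y := by
    refine Submodule.linearMap_qext _ (LinearMap.ext fun φ => ?_)
    simp only [LinearMap.comp_apply, Submodule.mkQ_apply, LinearMap.add_apply, Submodule.mapQ_apply,
      map_add, Submodule.Quotient.mk_add]
  map_smul' a X := by
    refine Submodule.linearMap_qext _ (LinearMap.ext fun φ => ?_)
    simp only [LinearMap.comp_apply, Submodule.mkQ_apply, LinearMap.smul_apply, Submodule.mapQ_apply,
      map_smul, RingHom.id_apply, Submodule.Quotient.mk_smul]

/-- Unfolding: `π.lieRepLinear X [φ] = [X φ]`. [folklore] -/
theorem lieRepLinear_mk (X : (AutomorphyDatum.gl n K hcpt).arch.lie) (φ : π.W) :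
    π.lieRepLinear X (Submodule.Quotient.mk φ) = Submodule.Quotient.mk (π.lieDerivW X φ) := rfl

/-- **The Lie algebra action of `π` on `W / W'`**: the action `π.lieRepW` descends to the quotient
by the stable subspace `W'`, as a morphism of real Lie algebras `𝔤𝔩_n(K_∞) →ₗ⁅ℝ⁆ End_ℂ (W / W')`.
Borel–Jacquet 1979, 4.6. [cite: BorelJacquet1979, 4.6] -/
def lieRep : (AutomorphyDatum.gl n K hcpt).arch.lie →ₗ⁅ℝ⁆ Module.End ℂ π.Quot :=
  { π.lieRepLinear with
    map_lie' := fun {X Y} => by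
      refine Submodule.linearMap_qext _ (LinearMap.ext fun φ => ?_)
      change π.lieRepLinear ⁅X, Y⁆ (Submodule.Quotient.mk φ) =
        ⁅π.lieRepLinear X, π.lieRepLinear Y⁆ (Submodule.Quotient.mk φ)
      rw [LieRing.of_associative_ring_bracket, LinearMap.sub_apply, Module.End.mul_apply,
        Module.End.mul_apply, lieRepLinear_mk, lieRepLinear_mk, lieRepLinear_mk, lieRepLinear_mk,
        lieRepLinear_mk, ← Submodule.Quotient.mk_sub]
      congr 1
      have h := LinearMap.congr_fun (LieHom.map_lie π.lieRepW X Y) φ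
      rw [LieRing.of_associative_ring_bracket] at h
      exact h }

/-- Unfolding: `π.lieRep X [φ] = [X φ]`. [folklore] -/
theorem lieRep_mkQ (X : (AutomorphyDatum.gl n K hcpt).arch.lie) (φ : π.W) :
    π.lieRep X (π.mkQ φ) = π.mkQ (π.lieDerivW X φ) := rfl

/-- **`π.lieRep` is the Lie algebra action of `π`** (`HasLieAction`: `ρ𝔤 X [φ] = [X φ]`).
Borel–Jacquet 1979, 4.6. [cite: BorelJacquet1979, 4.6] -/
theorem hasLieAction_lieRep : π.HasLieAction π.lieRep := fun X φ => π.lieRep_mkQ X φ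

/-- **Discharge of the named fact `AutomorphicRepData.exists_hasLieAction` for `GL_n`**: every
automorphic representation datum `π = W / W'` of `GL_n(𝔸_K)` admits (the unique,
`hasLieAction_unique`) Lie algebra action `ρ𝔤 X [φ] = [X φ]`, namely `π.lieRep`.
Borel–Jacquet 1979, §1.5 and 4.6. [cite: BorelJacquet1979, 4.6] -/
theorem exists_hasLieAction_gl : π.exists_hasLieAction := ⟨π.lieRep, π.hasLieAction_lieRep⟩

end AutomorphicRepData

end Literature.NumberTheory.Automorphic
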